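import Literature.Probability.Percolation.SlabRSWSnapConnector
import HarnessLib

/-!
# Newman–Tassion–Wu 2017, Lemma 3.16 on the coarse-grained domain — the crossing step

Topic: `Literature/Probability/Percolation`. Second half of the probabilistic chain of Lemma 3.16
for the coarse-grained gluing datum `Q₂ = snapGlue k n hn Γ` (`SlabRSWSnapDatum.lean`,
`SlabRSWSnapConnector.lean`):

* **`mem_evNear_snapGlue`** — (CROSS₂) a lattice configuration in `Q₂.evAB = {C ⟷^{R'∖N} τN∖N}`
  and in the mirror event `{τC ⟷^{τ(R'∖N)} τ(τN∖N)}` lies in `Q₂.evNear 0`: the minimal path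
  `Γ₁ ⊆ R' ∖ N` of the first event and an open path `P₂ ⊆ R' ∖ τN` of the second share a column.
  Planar crossing (`planarCrossing_rect'`) in `[-2,14n+2]×[-2,13n-1]` of
  `stub ∪ Γ̄₁ ∪ W₁ ∪ stub` (left to right) against `column ∪ P̄₂ ∪ W₂ ∪ column` (top to bottom),
  where `W₂ ⊆ N ∩ {0 ≤ x ≤ 7n-1}` is the connector from the last cell of `P₂` to `Γ̄₀ = (0,a₂)`
  and `W₁ ⊆ τN ∩ {7n+1 ≤ x}` is the mirror image of the connector from `τ`(last cell of `Γ₁`);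
  since `Γ̄₁ ∩ N = ∅`, `P̄₂ ∩ τN = ∅`, `W₁ ∩ W₂ = ∅` and the stubs sit at heights
  `a₂ ≤ 4n-1 < 5n ≤ h₁, h₂`, the meeting cell lies on `Γ̄₁ ∩ P̄₂` (no special case on the axis,
  unlike the thin datum);
(Harris–FKG and the assembly of `(H316)` follow in `SlabRSWSnapLemma316.lean`.)

## Sources

* C. M. Newman, V. Tassion, W. Wu, *Critical percolation and the minimal spanning tree in slabs*,
  Comm. Pure Appl. Math. 70 (2017), arXiv:1512.09107: §3.5, Lemma 3.16 and its proof ("any path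
  from top to bottom in `R` must intersect `γ ∪ γ'`"; the application of Theorem 3.6 in `K_□`;
  Harris–FKG for the symmetric pair), proof of Theorem 3.14, Case 3 ((3.49)–(3.52))
  [NewmanTassionWu2017].
-/

noncomputable section

namespace Literature.Probability.Percolation

open MeasureTheory LatticeModels SimpleGraph

namespace NTW17

variable {k : ℕ}

/-! ## The crossing step for the coarse datum -/

section Cross

variable {n : ℕ} (hn : 1 ≤ n) {ω ω' : BondConfig (slab 3 k)}

/-- **(CROSS₂) — the crossing step of Lemma 3.16 for the coarse datum.** Let `ω` be an admissible
lattice configuration (`A ⟷^{S'} B`), `Γ = Q.γ ω`, `Q₂ = snapGlue k n hn Γ`. A lattice configuration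
`ω'` in `Q₂.evAB = {C ⟷^{R'∖N} τN∖N}` and in the mirror event `{τC ⟷^{τ(R'∖N)} τ(τN∖N)}` is in
`Q₂.evNear 0`: an open path of the second event meets a column of the minimal path `Γ₁` of the first.
[cite: NewmanTassionWu2017, §3.5 (proof of Lemma 3.16, application of Theorem 3.6 in K_□: the paths from Y to γ′ and from Y′ to γ cross)] -/
theorem mem_evNear_snapGlue (hω : ω ⊆ (slabGraph 3 k).edgeSet) (hA : ω ∈ (case2Setup n hn).Q.evAB k)
    (hω' : ω' ⊆ (slabGraph 3 k).edgeSet)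
    (h₁ : ω' ∈ (snapGlue k n hn ((case2Setup n hn).Q.γ k ω)).evAB k)
    (h₂ : ω' ∈ slabConn k
      (planarReflect (14 * (n : ℤ)) '' (snapGlue k n hn ((case2Setup n hn).Q.γ k ω)).S)
      (planarReflect (14 * (n : ℤ)) '' (snapGlue k n hn ((case2Setup n hn).Q.γ k ω)).A)
      (planarReflect (14 * (n : ℤ)) '' (snapGlue k n hn ((case2Setup n hn).Q.γ k ω)).B)) :
    ω' ∈ (snapGlue k n hn ((case2Setup n hn).Q.γ k ω)).evNear k 0 := by
  set E := case2Setup n hn with hE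
  set Γ := E.Q.γ k ω with hΓdef
  set τ := planarReflect (14 * (n : ℤ)) with hτ
  set Q₂ := snapGlue k n hn Γ with hQ₂
  obtain ⟨hΓO, -⟩ := E.Q.γ_spec hA
  have h0 : Γ ≠ [] := hΓO.ne_nil
  -- `Γ` in coordinates
  have hΓS' : ∀ g ∈ Γ, 0 ≤ (planar k g).1 ∧ (planar k g).1 ≤ 7 * n ∧ 0 ≤ (planar k g).2 ∧
      (planar k g).2 ≤ 8 * n - 1 := by
    intro g hg
    have := hΓO.subset g hg
    rw [mem_slabLift_iff, show E.Q.S = boxR 0 (7 * n) 0 (8 * n - 1) from rfl, mem_boxR_iff] at this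
    exact this
  have hΓ7 : ∀ g ∈ Γ, (planar k g).1 ≤ 7 * n := fun g hg => (hΓS' g hg).2.1
  have haA : planar k (Γ.head h0) ∈ E.A := hΓO.head_mem h0
  rw [show E.A = sideSeg 0 0 (4 * n - 1) from rfl, sideSeg, Set.mem_setOf_eq] at haA
  set a₂ : ℤ := (planar k (Γ.head h0)).2 with ha₂
  have hpa : planar k (Γ.head h0) = (0, a₂) := Prod.ext haA.1 rfl
  have hτinvol : ∀ z : ℤ × ℤ, τ (τ z) = z := fun z => by
    rw [hτ, planarReflect_apply, planarReflect_apply]; ext <;> simp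
  -- `Γ₁`, the minimal path of `Q₂`: inside `R' ∖ N`, from `C̄` to `τN ∖ N`
  obtain ⟨hΓ₁O, -⟩ := Q₂.γ_spec h₁
  set Γ₁ := Q₂.γ k ω' with hΓ₁def
  have hΓ₁R : ∀ u ∈ Γ₁, planar k u ∈ E.R ∧ planar k u ∉ snapNbhd k n Γ := fun u hu => hΓ₁O.subset u hu
  have hΓ₁R' : ∀ u ∈ Γ₁, 0 ≤ (planar k u).1 ∧ (planar k u).1 ≤ 14 * n ∧ 0 ≤ (planar k u).2 ∧
      (planar k u).2 ≤ 13 * n - 1 := by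
    intro u hu
    have := (hΓ₁R u hu).1
    rw [show E.R = boxR 0 (14 * n) 0 (13 * n - 1) from rfl, mem_boxR_iff] at this
    exact this
  have hc₁ : planar k (Γ₁.head hΓ₁O.ne_nil) ∈ E.C := hΓ₁O.head_mem hΓ₁O.ne_nil
  rw [show E.C = sideSeg 0 (5 * n) (13 * n - 1) from rfl, sideSeg, Set.mem_setOf_eq] at hc₁
  set h₁ : ℤ := (planar k (Γ₁.head hΓ₁O.ne_nil)).2 with hh₁
  have hpc₁ : planar k (Γ₁.head hΓ₁O.ne_nil) = (0, h₁) := Prod.ext hc₁.1 rfl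
  -- the last cell `t₁ ∈ τN ∖ N` of `Γ₁`
  set t₁ : ℤ × ℤ := planar k (Γ₁.getLast hΓ₁O.ne_nil) with ht₁
  have ht₁B : τ t₁ ∈ snapNbhd k n Γ ∧ t₁ ∉ snapNbhd k n Γ := hΓ₁O.last_mem hΓ₁O.ne_nil
  have ht₁R : 0 ≤ t₁.1 ∧ t₁.1 ≤ 14 * n ∧ 0 ≤ t₁.2 ∧ t₁.2 ≤ 13 * n - 1 :=
    hΓ₁R' _ (List.getLast_mem hΓ₁O.ne_nil)
  have hτt₁x : (τ t₁).1 ≤ 7 * n - 1 :=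
    fst_lt_of_mem_diff hΓ7 ht₁B.1 fun h => ht₁B.2 (reflect_mem_snapNbhdR_iff.1 h)
  obtain ⟨g, hg, hgt⟩ : ∃ g ∈ Γ, τ t₁ ∈ sqBox (snap n (planar k g)) 40 := ht₁B.1
  -- `P₂`, an open path of the mirror event: inside `R' ∖ τN`, from `τC̄` to `N ∖ τN`
  obtain ⟨P₂, hP₂⟩ := (mem_slabConn_iff_exists_isOSAP ω' _ _ _).1 h₂
  have hP₂R : ∀ q ∈ P₂, ∃ w ∈ E.R, w ∉ snapNbhd k n Γ ∧ planar k q = τ w := by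
    intro q hq
    obtain ⟨w, ⟨hwR, hwN⟩, hw⟩ := hP₂.subset q hq
    exact ⟨w, hwR, hwN, hw.symm⟩
  have hP₂R' : ∀ q ∈ P₂, 0 ≤ (planar k q).1 ∧ (planar k q).1 ≤ 14 * n ∧ 0 ≤ (planar k q).2 ∧
      (planar k q).2 ≤ 13 * n - 1 := by
    intro q hq
    obtain ⟨w, hwR, -, hqw⟩ := hP₂R q hq
    rw [show E.R = boxR 0 (14 * n) 0 (13 * n - 1) from rfl, mem_boxR_iff] at hwR
    rw [hqw, hτ, planarReflect_apply]
    simp only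
    omega
  have hP₂N : ∀ q ∈ P₂, τ (planar k q) ∉ snapNbhd k n Γ := by
    intro q hq
    obtain ⟨w, -, hwN, hqw⟩ := hP₂R q hq
    rw [hqw, hτinvol]; exact hwN
  obtain ⟨w₂, hw₂C, hc₂⟩ : ∃ w ∈ E.C, τ w = planar k (P₂.head hP₂.ne_nil) := hP₂.head_mem hP₂.ne_nil
  rw [show E.C = sideSeg 0 (5 * n) (13 * n - 1) from rfl, sideSeg, Set.mem_setOf_eq] at hw₂C
  set h₂ : ℤ := w₂.2 with hh₂
  have hpc₂ : planar k (P₂.head hP₂.ne_nil) = ((14 : ℤ) * n, h₂) := by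
    rw [← hc₂, hτ, planarReflect_apply, hw₂C.1]; simp [hh₂]
  -- the last cell `t₂ ∈ N ∖ τN` of `P₂`
  set t₂ : ℤ × ℤ := planar k (P₂.getLast hP₂.ne_nil) with ht₂
  obtain ⟨w', ⟨hw'R, hw'N⟩, hw't⟩ :
      ∃ w', w' ∈ snapNbhdR k n Γ \ snapNbhd k n Γ ∧ τ w' = t₂ := hP₂.last_mem hP₂.ne_nil
  have ht₂N : t₂ ∈ snapNbhd k n Γ := by rw [← hw't]; exact hw'R
  have ht₂τ : τ t₂ ∉ snapNbhd k n Γ := by rw [← hw't, hτinvol]; exact hw'N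
  have ht₂R : 0 ≤ t₂.1 ∧ t₂.1 ≤ 14 * n ∧ 0 ≤ t₂.2 ∧ t₂.2 ≤ 13 * n - 1 :=
    hP₂R' _ (List.getLast_mem hP₂.ne_nil)
  have ht₂x : t₂.1 ≤ 7 * n - 1 := fst_lt_of_mem_diff hΓ7 ht₂N fun h => ht₂τ (mem_snapNbhdR_iff.1 h)
  obtain ⟨g', hg', hg't⟩ : ∃ g' ∈ Γ, t₂ ∈ sqBox (snap n (planar k g')) 40 := ht₂N
  -- the connectors
  obtain ⟨W₂, hW₂ne, hwW₂, hW₂hd, hW₂lt, hW₂mem⟩ := exists_connector hn hω hA h0 hg' hg't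
    (by rw [mem_boxR_iff]; exact ht₂R) ht₂x
  obtain ⟨V₁, hV₁ne, hwV₁, hV₁hd, hV₁lt, hV₁mem⟩ := exists_connector hn hω hA h0 hg hgt
    (by rw [mem_boxR_iff, hτ, planarReflect_apply]; simp only; omega) hτt₁x
  set W₁ : List (ℤ × ℤ) := V₁.map τ with hW₁
  have hW₁ne : W₁ ≠ [] := by simpa [hW₁] using hV₁ne
  have hwW₁ : IsPlanarWalk W₁ := hwV₁.map (planarAdj_planarReflect _)
  have hW₁hd : W₁.head? = some t₁ := by rw [hW₁, List.head?_map, hV₁hd, Option.map_some, hτinvol]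
  have hW₁lt : W₁.getLast? = some ((14 : ℤ) * n, a₂) := by
    rw [hW₁, List.getLast?_map, hV₁lt, Option.map_some, hpa, hτ, planarReflect_apply]
    simp
  have hW₁mem : ∀ z ∈ W₁, τ z ∈ snapNbhd k n Γ ∧ 7 * n + 1 ≤ z.1 ∧ z.1 ≤ 14 * n ∧ 0 ≤ z.2 ∧
      z.2 ≤ 13 * n - 1 := by
    intro z hz
    rw [hW₁, List.mem_map] at hz
    obtain ⟨v, hv, rfl⟩ := hz
    have h := hV₁mem v hv
    rw [hτinvol]
    refine ⟨h.1, ?_⟩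
    rw [hτ, planarReflect_apply]; simp only; omega
  rw [hpa] at hW₂lt
  -- the projections of `Γ₁` and `P₂`
  set pΓ₁ : List (ℤ × ℤ) := Γ₁.map (planar k) with hpΓ₁
  set pP₂ : List (ℤ × ℤ) := P₂.map (planar k) with hpP₂
  have hpΓ₁ne : pΓ₁ ≠ [] := by simpa [hpΓ₁] using hΓ₁O.ne_nil
  have hpP₂ne : pP₂ ≠ [] := by simpa [hpP₂] using hP₂.ne_nil
  have hwΓ₁ : IsPlanarWalk pΓ₁ := isPlanarWalk_map_planar hω' hΓ₁O.chain
  have hwP₂ : IsPlanarWalk pP₂ := isPlanarWalk_map_planar hω' hP₂.chain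
  have hpΓ₁hd : pΓ₁.head? = some ((0 : ℤ), h₁) := by
    rw [hpΓ₁, List.head?_map, List.head?_eq_some_head hΓ₁O.ne_nil, Option.map_some, hpc₁]
  have hpΓ₁lt : pΓ₁.getLast? = some t₁ := by
    rw [hpΓ₁, List.getLast?_map, List.getLast?_eq_some_getLast hΓ₁O.ne_nil, Option.map_some]
  have hpP₂hd : pP₂.head? = some ((14 : ℤ) * n, h₂) := by
    rw [hpP₂, List.head?_map, List.head?_eq_some_head hP₂.ne_nil, Option.map_some, hpc₂]
  have hpP₂lt : pP₂.getLast? = some t₂ := by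
    rw [hpP₂, List.getLast?_map, List.getLast?_eq_some_getLast hP₂.ne_nil, Option.map_some]
  have hpΓ₁S : ∀ v ∈ pΓ₁, (0 ≤ v.1 ∧ v.1 ≤ 14 * n ∧ 0 ≤ v.2 ∧ v.2 ≤ 13 * n - 1) ∧ v ∉ snapNbhd k n Γ := by
    intro v hv
    obtain ⟨u, hu, rfl⟩ := List.mem_map.1 hv
    exact ⟨hΓ₁R' u hu, (hΓ₁R u hu).2⟩
  have hpP₂S : ∀ v ∈ pP₂, (0 ≤ v.1 ∧ v.1 ≤ 14 * n ∧ 0 ≤ v.2 ∧ v.2 ≤ 13 * n - 1) ∧ τ v ∉ snapNbhd k n Γ := by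
    intro v hv
    obtain ⟨u, hu, rfl⟩ := List.mem_map.1 hv
    exact ⟨hP₂R' u hu, hP₂N u hu⟩
  -- the LR walk
  set LR : List (ℤ × ℤ) := (-2, h₁) :: (-1, h₁) ::
    (pΓ₁ ++ (W₁ ++ [(14 * (n : ℤ) + 1, a₂), (14 * (n : ℤ) + 2, a₂)])) with hLR
  have hLRne : LR ≠ [] := List.cons_ne_nil _ _
  have hwLR : IsPlanarWalk LR := by
    rw [hLR]
    have h3 : IsPlanarWalk (W₁ ++ [(14 * (n : ℤ) + 1, a₂), (14 * (n : ℤ) + 2, a₂)]) := by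
      refine isPlanarWalk_append hwW₁ ?_ fun x hx y hy => ?_
      · refine List.IsChain.cons_cons (Or.inr ?_) (List.IsChain.singleton _)
        left; left
        refine Prod.ext ?_ ?_ <;> simp only [Prod.fst_add, Prod.snd_add] <;> omega
      · rw [hW₁lt, Option.mem_def, Option.some.injEq] at hx
        rw [List.head?_cons, Option.mem_def, Option.some.injEq] at hy
        subst hx; subst hy
        right; left; left
        ext <;> simp
    have h2 : IsPlanarWalk (pΓ₁ ++ (W₁ ++ [(14 * (n : ℤ) + 1, a₂), (14 * (n : ℤ) + 2, a₂)])) := by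
      refine isPlanarWalk_append hwΓ₁ h3 fun x hx y hy => ?_
      rw [hpΓ₁lt, Option.mem_def, Option.some.injEq] at hx
      rw [List.head?_append, hW₁hd, Option.some_or, Option.mem_def, Option.some.injEq] at hy
      left; rw [← hx, ← hy]
    refine List.IsChain.cons_cons (Or.inr ?_) (List.IsChain.cons_of_ne_nil (by simp [hpΓ₁ne]) h2 ?_)
    · left; left; ext <;> simp
    · have : (pΓ₁ ++ (W₁ ++ [(14 * (n : ℤ) + 1, a₂), (14 * (n : ℤ) + 2, a₂)])).head
          (by simp [hpΓ₁ne]) = (0, h₁) := by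
        apply Option.some.inj
        rw [← List.head?_eq_some_head, List.head?_append, hpΓ₁hd, Option.some_or]
      rw [this]
      right; left; left; ext <;> simp
  -- the TB walk
  set m₂ : ℕ := (13 * (n : ℤ) - 1 - h₂).toNat with hm₂
  have hm₂c : h₂ + m₂ = 13 * n - 1 := by rw [hm₂, Int.toNat_of_nonneg (by omega)]; ring
  set m₃ : ℕ := (a₂ + 2).toNat with hm₃
  have hm₃c : (-2 : ℤ) + m₃ = a₂ := by rw [hm₃, Int.toNat_of_nonneg (by omega)]; ring
  set TB : List (ℤ × ℤ) := colWalk (14 * (n : ℤ) + 2) h₂ m₂ ++ ((14 * (n : ℤ) + 1, h₂) ::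
    (pP₂ ++ (W₂ ++ ((-1, a₂) :: colWalk (-2) (-2) m₃)))) with hTB
  have hTBne : TB ≠ [] := by simp [hTB, colWalk_ne_nil]
  have hwTB : IsPlanarWalk TB := by
    rw [hTB]
    have h4 : IsPlanarWalk (W₂ ++ ((-1, a₂) :: colWalk (-2) (-2) m₃)) := by
      refine isPlanarWalk_append hwW₂ ?_ fun x hx y hy => ?_
      · refine List.IsChain.cons_of_ne_nil (colWalk_ne_nil _ _ _) (isPlanarWalk_colWalk _ _ _) (Or.inr ?_)
        rw [head_colWalk, hm₃c]
        left; right; ext <;> simp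
      · rw [hW₂lt, Option.mem_def, Option.some.injEq] at hx
        rw [List.head?_cons, Option.mem_def, Option.some.injEq] at hy
        subst hx; subst hy
        right; left; right; ext <;> simp
    have h3 : IsPlanarWalk (pP₂ ++ (W₂ ++ ((-1, a₂) :: colWalk (-2) (-2) m₃))) := by
      refine isPlanarWalk_append hwP₂ h4 fun x hx y hy => ?_
      rw [hpP₂lt, Option.mem_def, Option.some.injEq] at hx
      rw [List.head?_append, hW₂hd, Option.some_or, Option.mem_def, Option.some.injEq] at hy
      left; rw [← hx, ← hy]
    have h2 : IsPlanarWalk (((14 * (n : ℤ) + 1, h₂) :: (pP₂ ++ (W₂ ++ ((-1, a₂) :: colWalk (-2) (-2) m₃))))) := by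
      refine List.IsChain.cons_of_ne_nil (by simp [hpP₂ne]) h3 (Or.inr ?_)
      have : (pP₂ ++ (W₂ ++ ((-1, a₂) :: colWalk (-2) (-2) m₃))).head (by simp [hpP₂ne]) =
          ((14 : ℤ) * n, h₂) := by
        apply Option.some.inj
        rw [← List.head?_eq_some_head, List.head?_append, hpP₂hd, Option.some_or]
      rw [this]
      left; right; ext <;> simp
    refine isPlanarWalk_append (isPlanarWalk_colWalk _ _ _) h2 fun x hx y hy => ?_
    rw [getLast?_colWalk, Option.mem_def, Option.some.injEq] at hx
    rw [List.head?_cons, Option.mem_def, Option.some.injEq] at hy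
    subst hx; subst hy
    right; left; right
    refine Prod.ext ?_ ?_ <;> simp only [Prod.fst_add, Prod.snd_add] <;> omega
  -- inside the big rectangle
  have hLRbox : ∀ v ∈ LR, v ∈ boxR (-2) (14 * n + 2) (-2) (13 * n - 1) := by
    intro v hv
    rw [mem_boxR_iff]
    rw [hLR, List.mem_cons, List.mem_cons, List.mem_append, List.mem_append] at hv
    rcases hv with rfl | rfl | hv | hv | hv
    · simp only; omega
    · simp only; omega
    · have := (hpΓ₁S v hv).1; omega
    · have := (hW₁mem v hv).2; omega
    · simp only [List.mem_cons, List.not_mem_nil, or_false] at hv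
      rcases hv with rfl | rfl <;> simp only <;> omega
  have hTBbox : ∀ v ∈ TB, v ∈ boxR (-2) (14 * n + 2) (-2) (13 * n - 1) := by
    intro v hv
    rw [mem_boxR_iff]
    rw [hTB, List.mem_append, mem_colWalk_iff, List.mem_cons, List.mem_append, List.mem_append,
      List.mem_cons, mem_colWalk_iff] at hv
    rcases hv with ⟨e1, e2, e3⟩ | rfl | hv | hv | rfl | ⟨e1, e2, e3⟩
    · omega
    · simp only; omega
    · have := (hpP₂S v hv).1; omega
    · have := (hW₂mem v hv).2; omega
    · simp only; omega
    · omega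
  -- endpoints
  have hLRhead : (LR.head hLRne).1 = -2 := by simp [hLR]
  have hLRlast : (LR.getLast hLRne).1 = 14 * n + 2 := by
    have e : LR = ((-2, h₁) :: (-1, h₁) :: (pΓ₁ ++ (W₁ ++ [(14 * (n : ℤ) + 1, a₂)]))) ++
        [(14 * (n : ℤ) + 2, a₂)] := by simp [hLR]
    rw [List.getLast_congr hLRne (by simp) e, List.getLast_append_of_ne_nil _ (List.cons_ne_nil _ _),
      List.getLast_singleton]
  have hTBhead : (TB.head hTBne).2 = 13 * n - 1 := by
    have : TB.head hTBne = ((14 : ℤ) * n + 2, h₂ + m₂) := by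
      apply Option.some.inj
      rw [← List.head?_eq_some_head hTBne, hTB, List.head?_append, head?_colWalk, Option.some_or]
    rw [this]; exact hm₂c
  have hTBlast : (TB.getLast hTBne).2 = -2 := by
    have e : TB = (colWalk (14 * (n : ℤ) + 2) h₂ m₂ ++ ((14 * (n : ℤ) + 1, h₂) ::
        (pP₂ ++ (W₂ ++ [(-1, a₂)])))) ++ colWalk (-2) (-2) m₃ := by simp [hTB]
    rw [List.getLast_congr hTBne (by simp [colWalk_ne_nil]) e,
      List.getLast_append_of_ne_nil _ (colWalk_ne_nil _ _ _), getLast_colWalk]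
  -- the crossing
  obtain ⟨v, hvLR, hvTB⟩ := planarCrossing_rect' (a := -2) (b := 14 * (n : ℤ) + 2) (c := -2)
    (d := 13 * (n : ℤ) - 1) (A := {v | v.1 = -2}) (B := {v | v.1 = 14 * (n : ℤ) + 2})
    (C := {v | v.2 = 13 * (n : ℤ) - 1}) (D := {v | v.2 = -2}) (fun _ h => h) (fun _ h => h) (fun _ h => h)
    (fun _ h => h) LR TB hLRne hTBne hwLR hwTB hLRbox hTBbox hLRhead hLRlast hTBhead hTBlast
  rw [hLR, List.mem_cons, List.mem_cons, List.mem_append, List.mem_append] at hvLR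
  rw [hTB, List.mem_append, mem_colWalk_iff, List.mem_cons, List.mem_append, List.mem_append,
    List.mem_cons, mem_colWalk_iff] at hvTB
  have hgood : v ∈ pΓ₁ ∧ v ∈ pP₂ := by
    rcases hvLR with rfl | rfl | hvΓ₁ | hvW₁ | hvst
    · -- `(-2, h₁)`: left of everything in `TB` except the bottom column, which is lower
      exfalso
      rcases hvTB with ⟨e1, -, -⟩ | e | hv | hv | e | ⟨-, -, e3⟩
      · simp only at e1; omega
      · simp only [Prod.mk.injEq] at e; omega
      · have := (hpP₂S _ hv).1; simp only at this; omega
      · have := (hW₂mem _ hv).2; simp only at this; omega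
      · simp only [Prod.mk.injEq] at e; omega
      · simp only at e3; omega
    · -- `(-1, h₁)`: only `(-1, a₂)` has `x = -1`, at a different height
      exfalso
      rcases hvTB with ⟨e1, -, -⟩ | e | hv | hv | e | ⟨e1, -, -⟩
      · simp only at e1; omega
      · simp only [Prod.mk.injEq] at e; omega
      · have := (hpP₂S _ hv).1; simp only at this; omega
      · have := (hW₂mem _ hv).2; simp only at this; omega
      · simp only [Prod.mk.injEq] at e; omega
      · simp only at e1; omega
    · -- on `Γ̄₁ ⊆ R' ∖ N`
      obtain ⟨hb, hvN⟩ := hpΓ₁S v hvΓ₁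
      rcases hvTB with ⟨e1, -, -⟩ | rfl | hv | hv | rfl | ⟨e1, -, -⟩
      · exfalso; omega
      · exfalso; simp only at hb; omega
      · exact ⟨hvΓ₁, hv⟩
      · exfalso; exact hvN (hW₂mem v hv).1
      · exfalso; simp only at hb; omega
      · exfalso; omega
    · -- on `W₁ ⊆ τN ∩ {x ≥ 7n+1}`
      exfalso
      obtain ⟨hvN, hb⟩ := hW₁mem v hvW₁
      rcases hvTB with ⟨e1, -, -⟩ | rfl | hv | hv | rfl | ⟨e1, -, -⟩
      · omega
      · simp only at hb; omega
      · exact (hpP₂S v hv).2 hvN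
      · have := (hW₂mem v hv).2; omega
      · simp only at hb; omega
      · omega
    · -- right stubs
      exfalso
      simp only [List.mem_cons, List.not_mem_nil, or_false] at hvst
      rcases hvst with rfl | rfl
      · rcases hvTB with ⟨e0, -, -⟩ | e | hv | hv | e | ⟨e1, -, -⟩
        · simp only at e0; omega
        · simp only [Prod.mk.injEq] at e; omega
        · have := (hpP₂S _ hv).1; simp only at this; omega
        · have := (hW₂mem _ hv).2; simp only at this; omega
        · simp only [Prod.mk.injEq] at e; omega
        · simp only at e1; omega
      · rcases hvTB with ⟨-, e2, -⟩ | e | hv | hv | e | ⟨e1, -, -⟩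
        · simp only at e2; omega
        · simp only [Prod.mk.injEq] at e; omega
        · have := (hpP₂S _ hv).1; simp only at this; omega
        · have := (hW₂mem _ hv).2; simp only at this; omega
        · simp only [Prod.mk.injEq] at e; omega
        · simp only at e1; omega
  -- conclusion: `P₂` reaches a column of `Γ₁`
  obtain ⟨hvΓ₁, hvP₂⟩ := hgood
  obtain ⟨g₁, hg₁, hvg₁⟩ := List.mem_map.1 hvΓ₁
  obtain ⟨q, hq, hvq⟩ := List.mem_map.1 hvP₂
  obtain ⟨pq, sq, hpq⟩ := List.append_of_mem hq
  have hsub : ∀ x ∈ pq ++ [q], x ∈ slabLift k Q₂.R := by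
    intro x hx
    have hxP : x ∈ P₂ := by
      rw [hpq]
      rcases List.mem_append.1 hx with hx | hx
      · exact List.mem_append_left _ hx
      · rw [List.mem_singleton] at hx; subst hx; simp
    obtain ⟨w, hwR, -, hxw⟩ := hP₂R x hxP
    show planar k x ∈ E.R
    rw [hxw, show E.R = boxR 0 (14 * n) 0 (13 * n - 1) from rfl, ← image_reflect14_R n]
    exact Set.mem_image_of_mem _ hwR
  have hchain : (pq ++ [q]).IsChain (fun a b => s(a, b) ∈ ω' ∧ a ≠ b) := by
    have hc := hP₂.chain
    rw [hpq, ← List.singleton_append, ← List.append_assoc] at hc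
    exact (List.isChain_append.1 hc).1
  obtain ⟨a, l, hal⟩ := List.exists_cons_of_ne_nil (show pq ++ [q] ≠ [] by simp)
  have hahd : a = P₂.head hP₂.ne_nil := by
    have : P₂ = (a :: l) ++ sq := by rw [hpq, ← hal]; simp
    symm
    rw [List.head_eq_iff_head?_eq_some, this]; simp
  have hlast : (a :: l).getLast (List.cons_ne_nil a l) = q := by
    rw [List.getLast_congr _ (by simp) hal.symm]; simp
  have hconn : ω' ∈ openConnIn (slabLift k Q₂.R) (P₂.head hP₂.ne_nil) q := by
    rw [← hahd, ← hlast]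
    rw [hal] at hchain hsub
    exact openConnIn_of_isChain a l hchain hsub
  refine ⟨P₂.head hP₂.ne_nil, ?_, q, hconn, g₁, hg₁, ?_⟩
  · show planar k (P₂.head hP₂.ne_nil) ∈ τ '' E.C
    exact hP₂.head_mem hP₂.ne_nil
  · rw [hvq, ← hvg₁]; exact mem_sqBox_self _ _

end Cross

end NTW17

end Literature.Probability.Percolation
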